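import Mathlib
import HarnessLib
import Summits.HubbardSuperconductivity.HubbardSuperconductivity.Theorems.KLProgrammeH10TwoPointLimitSymbolLineDerivTwo
import Summits.HubbardSuperconductivity.HubbardSuperconductivity.Theorems.KLProgrammeH10TwoPointLimitSymbolSampledDifferences
import Summits.HubbardSuperconductivity.HubbardSuperconductivity.Theorems.KLProgrammeH10TwoPointLimitSymbolCellGeometry

/-!
# Route `KLProgramme` — engine support, route (L2) symbol layer (b₂)+(b₃) assembled for a SAMPLED symbol `G(k₀² + e(p)²)·Z(p)` on
# `(ℤ/Pℤ)¹ × (ℤ/Lℤ)²`: support, sup, and the POINTWISE second differences in the time direction and in any integer spatial direction —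
# the inputs `h₀…h₃` of the master lemma `sum_norm_charSum_le_of_second_differences`

Cell `gate-hubbard-kl`, seat p4 (C5a lead), g6; HOME/prover-p4/FRAME-L22-NOTE.md §3″ (b₂)/(b₃).  Generic in: a cutoff PROFILE `G` at scale `Λ`
(`|G| ≤ g₀`, `|G′| ≤ g₁/Λ²`, `|G″| ≤ g₂/Λ⁴`, `G = 0` above `Λ²`), a `C²` band `e` on `Fin 2 → ℝ` with `‖D²e‖ ≤ K₂`, a `C²` angular factor
`Z` (`|Z| ≤ z₀`; first/second LINE derivatives `≤ z₁`, `≤ z₂` on the shell `{|e| ≤ Λ}`), the continuum symbol `Φ(k₀, p) = G(k₀² + e(p)²)·Z(p)`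
and its sample `G̃(q) = Φ(a₀ + h₀·val q₁, hₓ·q̃₂)` (`a₀ + h₀ i` = the kept Matsubara frequencies, `hₓ = 2π/L`):

* `sampledSymbol_support` — `G̃(q) ≠ 0 ⇒ |k₀| ≤ Λ ∧ |e(p)| ≤ Λ ∧ Z(p) ≠ 0` at the sample point; `norm_sampledSymbol_le` — `‖G̃‖ ≤ g₀z₀`;
* **`norm_fwdDiff_two_time_sampledSymbol_le`** — if the frequency window sits two steps inside the kept frequencies
  (`Λ < |a₀ + h₀m|` for `m < 2` and `m ≥ P − 2`), then `‖Δ²_{(1,0)} G̃(q)‖ ≤ (4g₂ + 2g₁)h₀²z₀/Λ²` for EVERY `q`;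
* **`norm_fwdDiff_two_space_sampledSymbol_le`** — for an integer step `u` (`w = hₓu`) with `2hₓ|u_j| ≤ zm`, if the shell stays `zm`-inside the
  zone (`|p_j| ≥ π − zm ⇒ Λ < |e(p)|`), the support of `Z` on the shell (inside the square `|p_i| ≤ π + zm`) lies in the cell `‖p − p_F‖ ≤ ρ`, and `|De(p_F)w| ≤ τ₀` (the step is
  nearly TANGENT at the cell's Fermi point), then with `τ = τ₀ + K₂(ρ + 2‖w‖)‖w‖`:
  `‖Δ²_{(0,ū)} G̃(q)‖ ≤ ((4g₂+2g₁)τ²/Λ² + 2g₁K₂‖w‖²/Λ)z₀ + 4g₁τ/Λ·z₁ + g₀z₂` for EVERY `q` (zero unless one of the three samples is in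
  the cell; there the whole real segment is within `ρ + 2‖w‖` of `p_F`);
* `card_support_sampledSymbol_le` — `#{G̃ ≠ 0} ≤ #{time window} · #{cell momenta}` (the factors are counted by `card_filter_timeWindow_le`
  here and `card_filter_cell_le` of `…SymbolCellGeometry`).

Everything is proved; no definitions, no named facts. [folklore]  (BGM 2006 Lemma 2.2, (2.52)–(2.56), footnote ¹.)
-/

noncomputable section

namespace Summit.HubbardSuperconductivity.HubbardSuperconductivity.Theorems.TorusFourierL2

set_option linter.dupNamespace false -- summit = problem name (single-conjunct summit), D-0017

open Set Finset Filter Topology Literature.Probability.LatticeModels Literature.Analysis.Calculus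
open scoped Real

/-! ### §0 Two small calculus facts -/

/-- `iteratedDeriv n (s ↦ (f s : ℂ)) = (iteratedDeriv n f : ℂ)` for `f ∈ Cⁿ`. [folklore] -/
theorem iteratedDeriv_ofReal_comp {f : ℝ → ℝ} {n : ℕ} (hf : ContDiff ℝ n f) (s : ℝ) :
    iteratedDeriv n (fun s => ((f s : ℝ) : ℂ)) s = ((iteratedDeriv n f s : ℝ) : ℂ) := by
  have h := ContinuousLinearMap.iteratedFDeriv_comp_left Complex.ofRealCLM (hf.contDiffAt (x := s)) (i := n) le_rfl
  rw [iteratedDeriv_eq_iteratedFDeriv, iteratedDeriv_eq_iteratedFDeriv]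
  have e1 : (fun s => ((f s : ℝ) : ℂ)) = Complex.ofRealCLM ∘ f := by funext s; simp
  rw [e1, h]
  simp

/-- `‖(r : ℂ)‖ = |r|` under an iterated derivative: `‖∂ⁿ(ofReal ∘ f)‖ = |∂ⁿ f|`. [folklore] -/
theorem norm_iteratedDeriv_ofReal_comp {f : ℝ → ℝ} {n : ℕ} (hf : ContDiff ℝ n f) (s : ℝ) :
    ‖iteratedDeriv n (fun s => ((f s : ℝ) : ℂ)) s‖ = |iteratedDeriv n f s| := by
  rw [iteratedDeriv_ofReal_comp hf s, Complex.norm_real, Real.norm_eq_abs]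

/-! ### §1 Support and sup of the sampled symbol -/

section Sampled

variable {P L : ℕ} [NeZero P] [NeZero L]

omit [NeZero P] in
/-- The sampled momenta lie in the closed square: `|hₓ k̃_j| ≤ π` when `|hₓ|·L = 2π`. [folklore] -/
theorem abs_sample_le_pi {hx : ℝ} (hxL : |hx| * L = 2 * π) (k : TorusSite 2 L) (j : Fin 2) :
    |hx * (((k j).valMinAbs : ℤ) : ℝ)| ≤ π := by
  have hL : (0 : ℝ) < L := Nat.cast_pos.2 (Nat.pos_of_ne_zero (NeZero.ne L))
  have h1 : ((k j).valMinAbs.natAbs : ℝ) ≤ (L : ℝ) / 2 := by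
    have h := ZMod.natAbs_valMinAbs_le (k j)
    have h' : ((k j).valMinAbs.natAbs : ℝ) ≤ ((L / 2 : ℕ) : ℝ) := by exact_mod_cast h
    exact h'.trans (Nat.cast_div_le)
  have h2 : |(((k j).valMinAbs : ℤ) : ℝ)| = ((k j).valMinAbs.natAbs : ℝ) := by
    rw [← Int.cast_abs, Int.abs_eq_natAbs, Int.cast_natCast]
  rw [abs_mul, h2]
  calc |hx| * ((k j).valMinAbs.natAbs : ℝ) ≤ |hx| * ((L : ℝ) / 2) := mul_le_mul_of_nonneg_left h1 (abs_nonneg _)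
    _ = π := by linarith [hxL]

/-- **Support of the continuum symbol**: `G(k₀² + e(p)²)·Z(p) ≠ 0 ⇒ |k₀| ≤ Λ ∧ |e(p)| ≤ Λ ∧ Z(p) ≠ 0`. [folklore] -/
theorem symbol_support {G : ℝ → ℝ} {Λ : ℝ} (hΛ : 0 < Λ) (hGv : ∀ u, Λ ^ 2 < u → G u = 0) (e Z : (Fin 2 → ℝ) → ℝ)
    {k₀ : ℝ} {p : Fin 2 → ℝ} (h : G (k₀ ^ 2 + e p ^ 2) * Z p ≠ 0) : |k₀| ≤ Λ ∧ |e p| ≤ Λ ∧ Z p ≠ 0 := by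
  obtain ⟨hG, hZ⟩ := mul_ne_zero_iff.1 h
  have hu : k₀ ^ 2 + e p ^ 2 ≤ Λ ^ 2 := by
    by_contra hlt
    exact hG (hGv _ (not_le.1 hlt))
  refine ⟨abs_le_of_sq_add_le (sq_nonneg (e p)) hΛ.le hu, abs_le_of_sq_add_le (sq_nonneg k₀) hΛ.le (by linarith), hZ⟩

omit [NeZero P] [NeZero L] in
/-- **Support of the sampled symbol** at the sample point `(a₀ + h₀ val q₁, hₓ q̃₂)`. [folklore] -/
theorem sampledSymbol_support {G : ℝ → ℝ} {Λ : ℝ} (hΛ : 0 < Λ) (hGv : ∀ u, Λ ^ 2 < u → G u = 0) (e Z : (Fin 2 → ℝ) → ℝ)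
    (Φ : ℝ × (Fin 2 → ℝ) → ℂ) (hΦ : ∀ k₀ p, Φ (k₀, p) = ((G (k₀ ^ 2 + e p ^ 2) * Z p : ℝ) : ℂ)) (a₀ h₀ hx : ℝ)
    (Gs : TorusSite 1 P × TorusSite 2 L → ℂ)
    (hGs : ∀ q, Gs q = Φ (a₀ + h₀ * (((q.1 0).val : ℕ) : ℝ), fun j => hx * (((q.2 j).valMinAbs : ℤ) : ℝ)))
    {q : TorusSite 1 P × TorusSite 2 L} (h : Gs q ≠ 0) :
    |a₀ + h₀ * (((q.1 0).val : ℕ) : ℝ)| ≤ Λ ∧ |e (fun j => hx * (((q.2 j).valMinAbs : ℤ) : ℝ))| ≤ Λ ∧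
      Z (fun j => hx * (((q.2 j).valMinAbs : ℤ) : ℝ)) ≠ 0 := by
  rw [hGs, hΦ] at h
  exact symbol_support hΛ hGv e Z (fun h0 => h (by rw [h0]; simp))

omit [NeZero P] [NeZero L] in
/-- **Sup of the sampled symbol**: `‖G̃(q)‖ ≤ g₀z₀`. [folklore] -/
theorem norm_sampledSymbol_le {G : ℝ → ℝ} {g₀ z₀ : ℝ} (hG0 : ∀ u, |G u| ≤ g₀) (e Z : (Fin 2 → ℝ) → ℝ) (hZ0 : ∀ p, |Z p| ≤ z₀)
    (Φ : ℝ × (Fin 2 → ℝ) → ℂ) (hΦ : ∀ k₀ p, Φ (k₀, p) = ((G (k₀ ^ 2 + e p ^ 2) * Z p : ℝ) : ℂ)) (a₀ h₀ hx : ℝ)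
    (Gs : TorusSite 1 P × TorusSite 2 L → ℂ)
    (hGs : ∀ q, Gs q = Φ (a₀ + h₀ * (((q.1 0).val : ℕ) : ℝ), fun j => hx * (((q.2 j).valMinAbs : ℤ) : ℝ)))
    (q : TorusSite 1 P × TorusSite 2 L) : ‖Gs q‖ ≤ g₀ * z₀ := by
  rw [hGs, hΦ, Complex.norm_real, Real.norm_eq_abs, abs_mul]
  have hg : 0 ≤ g₀ := le_trans (abs_nonneg _) (hG0 0)
  exact mul_le_mul (hG0 _) (hZ0 _) (abs_nonneg _) hg

/-! ### §2 Time differences -/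

omit [NeZero L] in
/-- **Time direction, pointwise**: if the frequency window sits two steps inside the kept frequencies (`Λ < |a₀ + h₀ m|` for the integers
`m < 2` and `m ≥ P − 2`) then `‖Δ²_{(1,0)} G̃(q)‖ ≤ (4g₂ + 2g₁)·h₀²·z₀/Λ²` for every `q`.
[cite: BenfattoGiulianiMastropietro2006, §2.5 Lemma 2.2 (2.52), (2.56)] -/
theorem norm_fwdDiff_two_time_sampledSymbol_le {G : ℝ → ℝ} (hG : ContDiff ℝ 2 G) {Λ g₁ g₂ z₀ : ℝ} (hΛ : 0 < Λ)
    (hg₁ : 0 ≤ g₁) (hg₂ : 0 ≤ g₂) (hG1 : ∀ u, |deriv G u| ≤ g₁ / Λ ^ 2) (hG2 : ∀ u, |iteratedDeriv 2 G u| ≤ g₂ / Λ ^ 4)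
    (hGv : ∀ u, Λ ^ 2 < u → G u = 0) (e Z : (Fin 2 → ℝ) → ℝ) (hZ0 : ∀ p, |Z p| ≤ z₀)
    (Φ : ℝ × (Fin 2 → ℝ) → ℂ) (hΦ : ∀ k₀ p, Φ (k₀, p) = ((G (k₀ ^ 2 + e p ^ 2) * Z p : ℝ) : ℂ)) (a₀ h₀ hx : ℝ)
    (hwin : ∀ m : ℤ, (m < 2 ∨ (P : ℤ) ≤ m + 2) → Λ < |a₀ + h₀ * (m : ℝ)|)
    (Gs : TorusSite 1 P × TorusSite 2 L → ℂ)
    (hGs : ∀ q, Gs q = Φ (a₀ + h₀ * (((q.1 0).val : ℕ) : ℝ), fun j => hx * (((q.2 j).valMinAbs : ℤ) : ℝ)))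
    (q : TorusSite 1 P × TorusSite 2 L) :
    ‖((fwdDiff ((fun _ : Fin 1 => (1 : ZMod P)), (0 : TorusSite 2 L)))^[2] Gs) q‖ ≤ (4 * g₂ + 2 * g₁) * h₀ ^ 2 * z₀ / Λ ^ 2 := by
  -- the window: `Φ(a₀ + h₀ m, ·) = 0` for `m < 2` or `m ≥ P − 2`
  have hsupp : ∀ (m : ℤ) (k : Fin 2 → ℝ), (m < (2 : ℕ) ∨ (P : ℤ) ≤ m + (2 : ℕ)) → Φ (a₀ + h₀ * (m : ℝ), k) = 0 := by
    intro m k hm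
    have hm' : m < 2 ∨ (P : ℤ) ≤ m + 2 := by exact_mod_cast hm
    have hlt := hwin m hm'
    rw [hΦ]
    have hu : Λ ^ 2 < (a₀ + h₀ * (m : ℝ)) ^ 2 + e k ^ 2 := by
      have h1 : Λ ^ 2 < (a₀ + h₀ * (m : ℝ)) ^ 2 := by
        have := sq_lt_sq' (by linarith [abs_nonneg (a₀ + h₀ * (m : ℝ))]) hlt
        rw [sq_abs] at this; exact this
      nlinarith
    rw [hGv _ hu, zero_mul, Complex.ofReal_zero]
  -- the line through the sample point
  set k₀ : ℝ := a₀ + h₀ * (((q.1 0).val : ℕ) : ℝ) with hk₀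
  set k : Fin 2 → ℝ := fun j => hx * (((q.2 j).valMinAbs : ℤ) : ℝ) with hk
  have hline : (fun s : ℝ => Φ (((k₀, k) : ℝ × (Fin 2 → ℝ)) + s • ((h₀, 0) : ℝ × (Fin 2 → ℝ)))) =
      fun s => (((G ((k₀ + s * h₀) ^ 2 + e k ^ 2) * Z k : ℝ)) : ℂ) := by
    funext s; rw [timeLine_apply, hΦ]
  have hreal : ContDiff ℝ 2 fun s : ℝ => G ((k₀ + s * h₀) ^ 2 + e k ^ 2) * Z k := contDiff_two_symbol_timeLine hG _ _ _ _
  have hC : ContDiff ℝ 2 fun s : ℝ => Φ (((k₀, k) : ℝ × (Fin 2 → ℝ)) + s • ((h₀, 0) : ℝ × (Fin 2 → ℝ))) := by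
    rw [hline]; exact Complex.ofRealCLM.contDiff.comp hreal
  refine norm_fwdDiff_iter_time_apply_le Φ a₀ h₀ hx 2 Gs hGs hsupp q hC fun s _ => ?_
  rw [hline, norm_iteratedDeriv_ofReal_comp hreal]
  have h := abs_iteratedDeriv_two_symbol_timeLine_le hG hΛ hg₁ hg₂ hG1 hG2 hGv (sq_nonneg (e k)) k₀ h₀ (Z k) s
  have hZk := hZ0 k
  calc _ ≤ (4 * g₂ + 2 * g₁) * h₀ ^ 2 * |Z k| / Λ ^ 2 := h
    _ ≤ (4 * g₂ + 2 * g₁) * h₀ ^ 2 * z₀ / Λ ^ 2 := by gcongr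

/-! ### §3 Space differences along an integer step -/

omit [NeZero P] in
/-- **A nonzero sample two steps along `ū` sits on the STRAIGHT segment**: under the zone hypothesis, if `G̃(q + t•(0,ū)) ≠ 0` (`t ≤ 2`) then
`Φ(k₀, k⃗ + t•w) ≠ 0` with `k⃗ = hₓq̃₂`, `w = hₓu` (no wrap-around on the support). [folklore] -/
theorem sampledSymbol_shift_ne_zero (Φ : ℝ × (Fin 2 → ℝ) → ℂ) (a₀ h₀ hx : ℝ) (u : Fin 2 → ℤ)
    (hzone : ∀ (k₀ : ℝ) (m : Fin 2 → ℤ), (∃ j, (L : ℤ) ≤ 2 * |m j| + 2 * (2 : ℕ) * |u j|) → Φ (k₀, fun j => hx * (m j : ℝ)) = 0)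
    (Gs : TorusSite 1 P × TorusSite 2 L → ℂ)
    (hGs : ∀ q, Gs q = Φ (a₀ + h₀ * (((q.1 0).val : ℕ) : ℝ), fun j => hx * (((q.2 j).valMinAbs : ℤ) : ℝ)))
    (q : TorusSite 1 P × TorusSite 2 L) {t : ℕ} (ht : t ≤ 2)
    (h : Gs (q + t • ((0 : TorusSite 1 P), fun j => ((u j : ℤ) : ZMod L))) ≠ 0) :
    Φ (a₀ + h₀ * (((q.1 0).val : ℕ) : ℝ),
      (fun j => hx * (((q.2 j).valMinAbs : ℤ) : ℝ)) + (t : ℝ) • fun j => hx * (u j : ℝ)) ≠ 0 := by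
  set f : (Fin 2 → ℤ) → ℂ := fun m => Φ (a₀ + h₀ * (((q.1 0).val : ℕ) : ℝ), fun j => hx * (m j : ℝ)) with hf
  have hcons := section_consistent_valMinAbs (P := L) f u 2 (fun m hm => hzone _ m hm) q.2 t ht
  have hq : (q + t • ((0 : TorusSite 1 P), fun j => ((u j : ℤ) : ZMod L))).1 = q.1 := by simp
  have hq2 : ∀ j, (q + t • ((0 : TorusSite 1 P), fun j => ((u j : ℤ) : ZMod L))).2 j = q.2 j + (t : ZMod L) * ((u j : ℤ) : ZMod L) := by
    intro j; simp [nsmul_eq_mul]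
  rw [hGs, hq] at h
  have h' : f (fun j => (q.2 j + (t : ZMod L) * ((u j : ℤ) : ZMod L)).valMinAbs) ≠ 0 := by
    rw [hf]
    convert h using 3
    rw [hq2]
  rw [← hcons, hf] at h'
  convert h' using 3
  funext j
  simp only [Pi.add_apply, Pi.smul_apply, smul_eq_mul]
  push_cast
  ring_nf

/-- **Space direction, pointwise** — see the module docstring; `τ = τ₀ + K₂(ρ + 2‖w‖)‖w‖`, `w = hₓu`.
[cite: BenfattoGiulianiMastropietro2006, §2.5 Lemma 2.2 (2.53)–(2.55)] -/
theorem norm_fwdDiff_two_space_sampledSymbol_le {G : ℝ → ℝ} (hG : ContDiff ℝ 2 G) {Λ g₀ g₁ g₂ : ℝ} (hΛ : 0 < Λ)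
    (hg₀ : 0 ≤ g₀) (hg₁ : 0 ≤ g₁) (hg₂ : 0 ≤ g₂) (hG0 : ∀ u, |G u| ≤ g₀) (hG1 : ∀ u, |deriv G u| ≤ g₁ / Λ ^ 2)
    (hG2 : ∀ u, |iteratedDeriv 2 G u| ≤ g₂ / Λ ^ 4) (hGv : ∀ u, Λ ^ 2 < u → G u = 0)
    {e : (Fin 2 → ℝ) → ℝ} (he : ContDiff ℝ 2 e) {K₂ : ℝ} (hK₂ : ∀ p, ‖iteratedFDeriv ℝ 2 e p‖ ≤ K₂)
    {Z : (Fin 2 → ℝ) → ℝ} (hZ : ContDiff ℝ 2 Z) {z₀ z₁ z₂ : ℝ} (hz₀ : 0 ≤ z₀) (hz₁ : 0 ≤ z₁) (hz₂ : 0 ≤ z₂)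
    (hZ0 : ∀ p, |Z p| ≤ z₀) (w : Fin 2 → ℝ)
    (hZ1 : ∀ (p₀ : Fin 2 → ℝ) (s : ℝ), |e (p₀ + s • w)| ≤ Λ → |deriv (fun s : ℝ => Z (p₀ + s • w)) s| ≤ z₁)
    (hZ2 : ∀ (p₀ : Fin 2 → ℝ) (s : ℝ), |e (p₀ + s • w)| ≤ Λ → |iteratedDeriv 2 (fun s : ℝ => Z (p₀ + s • w)) s| ≤ z₂)
    {pF : Fin 2 → ℝ} {ρ τ₀ zm : ℝ} (hρ : 0 ≤ ρ) (hτ₀ : |fderiv ℝ e pF w| ≤ τ₀)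
    (hcell : ∀ p : Fin 2 → ℝ, (∀ i, |p i| ≤ π + zm) → |e p| ≤ Λ → Z p ≠ 0 → ‖p - pF‖ ≤ ρ)
    (Φ : ℝ × (Fin 2 → ℝ) → ℂ) (hΦ : ∀ k₀ p, Φ (k₀, p) = ((G (k₀ ^ 2 + e p ^ 2) * Z p : ℝ) : ℂ)) (a₀ h₀ hx : ℝ)
    (u : Fin 2 → ℤ) (hw : w = fun j => hx * (u j : ℝ)) (hu : ∀ j, 2 * |hx| * |(u j : ℝ)| ≤ zm)
    (hzone : ∀ p : Fin 2 → ℝ, (∃ j, π - zm ≤ |p j|) → Λ < |e p|) (hxL : |hx| * L = 2 * π)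
    (Gs : TorusSite 1 P × TorusSite 2 L → ℂ)
    (hGs : ∀ q, Gs q = Φ (a₀ + h₀ * (((q.1 0).val : ℕ) : ℝ), fun j => hx * (((q.2 j).valMinAbs : ℤ) : ℝ)))
    (q : TorusSite 1 P × TorusSite 2 L) :
    ‖((fwdDiff ((0 : TorusSite 1 P), (fun j => ((u j : ℤ) : ZMod L))))^[2] Gs) q‖ ≤
      ((4 * g₂ + 2 * g₁) * (τ₀ + K₂ * (ρ + 2 * ‖w‖) * ‖w‖) ^ 2 / Λ ^ 2 + 2 * g₁ * (K₂ * ‖w‖ ^ 2) / Λ) * z₀ +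
        4 * g₁ * (τ₀ + K₂ * (ρ + 2 * ‖w‖) * ‖w‖) / Λ * z₁ + g₀ * z₂ := by
  have hK0 : 0 ≤ K₂ := le_trans (norm_nonneg _) (hK₂ pF)
  have hτ0' : 0 ≤ τ₀ := le_trans (abs_nonneg _) hτ₀
  set τ : ℝ := τ₀ + K₂ * (ρ + 2 * ‖w‖) * ‖w‖ with hτ
  have hτpos : 0 ≤ τ := by positivity
  have hRHS : 0 ≤ ((4 * g₂ + 2 * g₁) * τ ^ 2 / Λ ^ 2 + 2 * g₁ * (K₂ * ‖w‖ ^ 2) / Λ) * z₀ + 4 * g₁ * τ / Λ * z₁ + g₀ * z₂ := by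
    positivity
  -- the zone: `Φ(k₀, hₓ m) = 0` whenever `2|m_j| + 4|u_j| ≥ L`
  have hL : (0 : ℝ) < L := Nat.cast_pos.2 (Nat.pos_of_ne_zero (NeZero.ne L))
  have hzone' : ∀ (k₀ : ℝ) (m : Fin 2 → ℤ), (∃ j, (L : ℤ) ≤ 2 * |m j| + 2 * (2 : ℕ) * |u j|) →
      Φ (k₀, fun j => hx * (m j : ℝ)) = 0 := by
    intro k₀ m ⟨j, hj⟩
    have hj' : (L : ℝ) ≤ 2 * |(m j : ℝ)| + 4 * |(u j : ℝ)| := by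
      have := hj; push_cast at this ⊢; rw [← Int.cast_abs, ← Int.cast_abs]; exact_mod_cast (by linarith : (L:ℤ) ≤ 2*|m j| + 4*|u j|)
    have hpj : π - zm ≤ |hx * (m j : ℝ)| := by
      rw [abs_mul]
      have h1 : |hx| * L ≤ |hx| * (2 * |(m j : ℝ)| + 4 * |(u j : ℝ)|) := mul_le_mul_of_nonneg_left hj' (abs_nonneg _)
      have h2 := hu j
      nlinarith [abs_nonneg hx, abs_nonneg (m j : ℝ)]
    have hbig := hzone (fun j => hx * (m j : ℝ)) ⟨j, hpj⟩
    rw [hΦ]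
    have hu' : Λ ^ 2 < k₀ ^ 2 + e (fun j => hx * (m j : ℝ)) ^ 2 := by
      have := sq_lt_sq' (by linarith [abs_nonneg (e fun j => hx * (m j : ℝ))]) hbig
      rw [sq_abs] at this; nlinarith
    rw [hGv _ hu', zero_mul, Complex.ofReal_zero]
  -- trivial case: all three samples vanish
  by_cases hall : ∀ t : ℕ, t ≤ 2 → Gs (q + t • ((0 : TorusSite 1 P), fun j => ((u j : ℤ) : ZMod L))) = 0
  · rw [fwdDiff_iter_eq_zero_of_forall Gs _ 2 q hall, norm_zero]
    exact hRHS
  push Not at hall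
  obtain ⟨t, ht, hne⟩ := hall
  -- the sample point and the straight segment
  set k₀ : ℝ := a₀ + h₀ * (((q.1 0).val : ℕ) : ℝ) with hk₀
  set k : Fin 2 → ℝ := fun j => hx * (((q.2 j).valMinAbs : ℤ) : ℝ) with hk
  have hpt : Φ (k₀, k + (t : ℝ) • w) ≠ 0 := by
    rw [hw]; exact sampledSymbol_shift_ne_zero Φ a₀ h₀ hx u hzone' Gs hGs q ht hne
  rw [hΦ] at hpt
  obtain ⟨-, het, hZt⟩ := symbol_support hΛ hGv e Z (fun h0 => hpt (by rw [h0]; simp))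
  have hsq : ∀ i, |(k + (t : ℝ) • w) i| ≤ π + zm := by
    intro i
    have h1 : |k i| ≤ π := abs_sample_le_pi hxL q.2 i
    have h2 : |((t : ℝ) • w) i| ≤ zm := by
      rw [Pi.smul_apply, smul_eq_mul, abs_mul, hw]
      have ht' : |(t : ℝ)| ≤ 2 := by rw [abs_of_nonneg (Nat.cast_nonneg t)]; exact_mod_cast ht
      calc |(t : ℝ)| * |hx * (u i : ℝ)| ≤ 2 * |hx * (u i : ℝ)| := mul_le_mul_of_nonneg_right ht' (abs_nonneg _)
        _ = 2 * |hx| * |(u i : ℝ)| := by rw [abs_mul]; ring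
        _ ≤ zm := hu i
    calc |(k + (t : ℝ) • w) i| = |k i + ((t : ℝ) • w) i| := rfl
      _ ≤ |k i| + |((t : ℝ) • w) i| := abs_add_le _ _
      _ ≤ π + zm := add_le_add h1 h2
  have hnear_t : ‖k + (t : ℝ) • w - pF‖ ≤ ρ := hcell _ hsq het hZt
  -- every point of the segment `s ∈ [0, 2]` is within `ρ + 2‖w‖` of `p_F`
  have hnear : ∀ s ∈ Set.Icc (0 : ℝ) 2, ‖k + s • w - pF‖ ≤ ρ + 2 * ‖w‖ := by
    intro s hs
    have hts : |s - (t : ℝ)| ≤ 2 := by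
      have ht' : (t : ℝ) ≤ 2 := by exact_mod_cast ht
      have ht0 : (0 : ℝ) ≤ t := Nat.cast_nonneg t
      rw [abs_le]; constructor <;> linarith [hs.1, hs.2]
    calc ‖k + s • w - pF‖ = ‖(k + (t : ℝ) • w - pF) + (s - (t : ℝ)) • w‖ := by congr 1; rw [sub_smul]; abel
      _ ≤ ‖k + (t : ℝ) • w - pF‖ + ‖(s - (t : ℝ)) • w‖ := norm_add_le _ _
      _ ≤ ρ + 2 * ‖w‖ := by
          rw [norm_smul, Real.norm_eq_abs]
          exact add_le_add hnear_t (mul_le_mul_of_nonneg_right hts (norm_nonneg _))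
  -- the line function
  have hline : (fun s : ℝ => Φ (((k₀, k) : ℝ × (Fin 2 → ℝ)) + s • (((0 : ℝ), w) : ℝ × (Fin 2 → ℝ)))) =
      fun s => (((G (e (k + s • w) ^ 2 + k₀ ^ 2) * Z (k + s • w) : ℝ)) : ℂ) := by
    funext s; rw [spaceLine_apply, hΦ]; push_cast; ring
  have hZl : ContDiff ℝ 2 fun s : ℝ => Z (k + s • w) := hZ.comp (contDiff_const.add (contDiff_id.smul contDiff_const))
  have hreal : ContDiff ℝ 2 fun s : ℝ => G (e (k + s • w) ^ 2 + k₀ ^ 2) * Z (k + s • w) :=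
    contDiff_two_radialComp_mul hG (contDiff_two_line he k w) hZl _
  have hC : ContDiff ℝ 2 fun s : ℝ => Φ (((k₀, k) : ℝ × (Fin 2 → ℝ)) + s • (((0 : ℝ), w) : ℝ × (Fin 2 → ℝ))) := by
    rw [hline]; exact Complex.ofRealCLM.contDiff.comp hreal
  have hstep : (((0 : ℝ), w) : ℝ × (Fin 2 → ℝ)) = ((0 : ℝ), fun j => hx * (u j : ℝ)) := by rw [hw]
  have hmain : ∀ s ∈ Set.Icc (0 : ℝ) 2, ‖iteratedDeriv 2 (fun s : ℝ =>
      Φ (((k₀, k) : ℝ × (Fin 2 → ℝ)) + s • (((0 : ℝ), w) : ℝ × (Fin 2 → ℝ)))) s‖ ≤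
      ((4 * g₂ + 2 * g₁) * τ ^ 2 / Λ ^ 2 + 2 * g₁ * (K₂ * ‖w‖ ^ 2) / Λ) * z₀ + 4 * g₁ * τ / Λ * z₁ + g₀ * z₂ := by
    intro s hs
    rw [hline, norm_iteratedDeriv_ofReal_comp hreal]
    by_cases hsupp : Λ ^ 2 < e (k + s • w) ^ 2 + k₀ ^ 2
    · rw [(radialComp_mul_eq_zero_of_lt hG (contDiff_two_line he k w) hZl hGv (k₀ ^ 2) hsupp).2.2, abs_zero]
      exact hRHS
    · push Not at hsupp
      have hes : |e (k + s • w)| ≤ Λ := abs_le_of_sq_add_le (sq_nonneg k₀) hΛ.le hsupp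
      have h := abs_iteratedDeriv_two_symbol_spaceLine_le he hK₂ hG hZl hΛ hg₁ hg₂ hG0 hG1 hG2 hGv (sq_nonneg k₀) k w s
      have hdir : |fderiv ℝ e (k + s • w) w| ≤ τ := by
        have h1 := abs_fderiv_apply_le_of_near he hK₂ pF (k + s • w) w
        have h2 : K₂ * ‖k + s • w - pF‖ * ‖w‖ ≤ K₂ * (ρ + 2 * ‖w‖) * ‖w‖ :=
          mul_le_mul_of_nonneg_right (mul_le_mul_of_nonneg_left (hnear s hs) hK0) (norm_nonneg _)
        rw [hτ]; linarith
      have hsq : (fderiv ℝ e (k + s • w) w) ^ 2 ≤ τ ^ 2 := by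
        rw [← sq_abs]; exact pow_le_pow_left₀ (abs_nonneg _) hdir 2
      have hZ1s := hZ1 k s hes
      have hZ2s := hZ2 k s hes
      have hZ0s := hZ0 (k + s • w)
      calc _ ≤ ((4 * g₂ + 2 * g₁) * (fderiv ℝ e (k + s • w) w) ^ 2 / Λ ^ 2 + 2 * g₁ * (K₂ * ‖w‖ ^ 2) / Λ) * |Z (k + s • w)| +
            4 * g₁ * |fderiv ℝ e (k + s • w) w| / Λ * |deriv (fun s : ℝ => Z (k + s • w)) s| +
            g₀ * |iteratedDeriv 2 (fun s : ℝ => Z (k + s • w)) s| := h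
        _ ≤ ((4 * g₂ + 2 * g₁) * τ ^ 2 / Λ ^ 2 + 2 * g₁ * (K₂ * ‖w‖ ^ 2) / Λ) * z₀ + 4 * g₁ * τ / Λ * z₁ + g₀ * z₂ := by
            gcongr
  rw [hstep] at hC hmain
  exact norm_fwdDiff_iter_space_apply_le Φ a₀ h₀ hx 2 Gs hGs u hzone' q hC hmain

/-! ### §4 The support count factorises -/

/-- **Arithmetic progressions in a window**: `#{i < P : |a₀ + h₀ i| ≤ Λ} ≤ 2Λ/h₀ + 1` (`h₀ > 0`). [folklore] -/
theorem card_filter_timeWindow_le {a₀ h₀ Λ : ℝ} (hh : 0 < h₀) (hΛ : 0 ≤ Λ) :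
    (((univ : Finset (TorusSite 1 P)).filter fun i => |a₀ + h₀ * (((i 0).val : ℕ) : ℝ)| ≤ Λ).card : ℝ) ≤ 2 * Λ / h₀ + 1 := by
  classical
  set S := (univ : Finset (TorusSite 1 P)).filter fun i => |a₀ + h₀ * (((i 0).val : ℕ) : ℝ)| ≤ Λ with hS
  -- `i ↦ val (i 0)` is injective on `TorusSite 1 P` and maps `S` into the integers of an interval of length `2Λ/h₀`
  set lo : ℤ := ⌈(-Λ - a₀) / h₀⌉ with hlo
  set hi : ℤ := ⌊(Λ - a₀) / h₀⌋ with hhi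
  have hmap : ∀ i ∈ S, (((i 0).val : ℕ) : ℤ) ∈ Finset.Icc lo hi := by
    intro i hi'
    have h := (Finset.mem_filter.1 hi').2
    rw [abs_le] at h
    rw [Finset.mem_Icc, hlo, hhi, Int.ceil_le, Int.le_floor]
    push_cast
    constructor
    · rw [div_le_iff₀ hh]; linarith [h.1]
    · rw [le_div_iff₀ hh]; linarith [h.2]
  have hinj : Set.InjOn (fun i : TorusSite 1 P => (((i 0).val : ℕ) : ℤ)) S := by
    intro i _ i' _ h
    simp only at h
    have h' : (i 0).val = (i' 0).val := by exact_mod_cast h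
    funext j
    have hj : j = 0 := Subsingleton.elim _ _
    subst hj
    exact ZMod.val_injective P h'
  have hcard := Finset.card_le_card_of_injOn (fun i : TorusSite 1 P => (((i 0).val : ℕ) : ℤ)) hmap hinj
  have hIcc : ((Finset.Icc lo hi).card : ℝ) ≤ 2 * Λ / h₀ + 1 := by
    rw [Int.card_Icc]
    rcases le_or_gt lo (hi + 1) with hle | hgt
    · have hz : ((hi + 1 - lo).toNat : ℤ) = hi + 1 - lo := Int.toNat_of_nonneg (by omega)
      have : ((hi + 1 - lo).toNat : ℝ) = ((hi + 1 - lo : ℤ) : ℝ) := by exact_mod_cast hz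
      rw [this]; push_cast
      have h1 : (hi : ℝ) ≤ (Λ - a₀) / h₀ := Int.floor_le _
      have h2 : (-Λ - a₀) / h₀ ≤ lo := Int.le_ceil _
      have h3 : (Λ - a₀) / h₀ - (-Λ - a₀) / h₀ = 2 * Λ / h₀ := by field_simp; ring
      linarith
    · have : (hi + 1 - lo).toNat = 0 := by omega
      rw [this]; norm_num; positivity
  calc (S.card : ℝ) ≤ (Finset.Icc lo hi).card := by exact_mod_cast hcard
    _ ≤ 2 * Λ / h₀ + 1 := hIcc

/-- **The support of the sampled symbol factorises into a time window times a momentum cell**: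
`#{G̃ ≠ 0} ≤ #{i : |a₀ + h₀ i| ≤ Λ} · #{k̃ : |e(hₓk̃)| ≤ Λ ∧ ‖hₓk̃ − p_F‖ ≤ ρ}`. [folklore] -/
theorem card_support_sampledSymbol_le {G : ℝ → ℝ} {Λ : ℝ} (hΛ : 0 < Λ) (hGv : ∀ u, Λ ^ 2 < u → G u = 0)
    (e Z : (Fin 2 → ℝ) → ℝ) {pF : Fin 2 → ℝ} {ρ zm : ℝ} (hzm : 0 ≤ zm)
    (hcell : ∀ p : Fin 2 → ℝ, (∀ i, |p i| ≤ π + zm) → |e p| ≤ Λ → Z p ≠ 0 → ‖p - pF‖ ≤ ρ)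
    (Φ : ℝ × (Fin 2 → ℝ) → ℂ) (hΦ : ∀ k₀ p, Φ (k₀, p) = ((G (k₀ ^ 2 + e p ^ 2) * Z p : ℝ) : ℂ)) (a₀ h₀ hx : ℝ)
    (hxL : |hx| * L = 2 * π) (Gs : TorusSite 1 P × TorusSite 2 L → ℂ)
    (hGs : ∀ q, Gs q = Φ (a₀ + h₀ * (((q.1 0).val : ℕ) : ℝ), fun j => hx * (((q.2 j).valMinAbs : ℤ) : ℝ)))
    [DecidablePred fun q : TorusSite 1 P × TorusSite 2 L => Gs q ≠ 0] :
    ((univ : Finset (TorusSite 1 P × TorusSite 2 L)).filter fun q => Gs q ≠ 0).card ≤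
      ((univ : Finset (TorusSite 1 P)).filter fun i => |a₀ + h₀ * (((i 0).val : ℕ) : ℝ)| ≤ Λ).card *
        ((univ : Finset (TorusSite 2 L)).filter fun k =>
          |e (fun j => hx * (((k j).valMinAbs : ℤ) : ℝ))| ≤ Λ ∧ ‖(fun j => hx * (((k j).valMinAbs : ℤ) : ℝ)) - pF‖ ≤ ρ).card := by
  classical
  rw [← Finset.card_product]
  refine Finset.card_le_card fun q hq => ?_
  have hne := (Finset.mem_filter.1 hq).2
  obtain ⟨h1, h2, h3⟩ := sampledSymbol_support hΛ hGv e Z Φ hΦ a₀ h₀ hx Gs hGs hne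
  have hsq : ∀ i, |(fun j => hx * (((q.2 j).valMinAbs : ℤ) : ℝ)) i| ≤ π + zm := fun i =>
    (abs_sample_le_pi hxL q.2 i).trans (by linarith)
  exact Finset.mem_product.2 ⟨Finset.mem_filter.2 ⟨Finset.mem_univ _, h1⟩,
    Finset.mem_filter.2 ⟨Finset.mem_univ _, h2, hcell _ hsq h2 h3⟩⟩

end Sampled

end Summit.HubbardSuperconductivity.HubbardSuperconductivity.Theorems.TorusFourierL2

end
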